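import Literature.Analysis.Convexity.PLMap
import Literature.AlgebraicTopology.Homotopy.StrongDeformationRetract
import HarnessLib

/-!
# The zero set of a non-negative simplexwise affine function is a strong deformation retract of its small sublevel sets

Topic `Literature/AlgebraicTopology/Homotopy` (PL topology of finite geometric simplicial complexes,
on the tree's carriers: Mathlib `Geometry.SimplicialComplex ℝ W`, the tree's simplexwise affine
interpolation `Literature.Analysis.Convexity.plMap` and strong deformation retracts
`IsStrongDeformationRetractOf`). The **regular-neighbourhood retraction** in the form needed to turn
a triangulation into deformation retractions of TUBES:

**Theorem** (`isStrongDeformationRetractOf_zeroSet_sublevel`). Let `K` be a finite geometric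
simplicial complex in a finite-dimensional real normed space `W`, and `ℓ : W → ℝ` a function which
is affine on every closed simplex of `K` and `≥ 0` at the vertices. Put `Z = {x ∈ |K| : ℓ x = 0}`.
If `0 < ε` and `ε ≤ ℓ(v)` for every vertex `v` with `ℓ(v) > 0`, then `Z` is a strong deformation
retract of the sublevel set `{x ∈ |K| : ℓ x < ε}`.

The deformation is the classical "push away from the complementary vertices" (Munkres, *Elements
of Algebraic Topology*, Lemma 70.1; Rourke–Sanderson, *Introduction to PL topology*, 3.9–3.11 on
derived neighbourhoods; van den Dries, *Tame Topology*, Ch. 8 (3.3)–(3.5)): writing a point of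
`|K|` in barycentric coordinates `x = Σ_v β_v(x) v` and `λ(x) = Σ_{ℓ(v) > 0} β_v(x)` (so
`ℓ(x) ≥ ε λ(x)`, whence `λ < 1` on `{ℓ < ε}`),
`H_t(x) = (1 - (1-t)λ(x))/(1 - λ(x)) · Σ_{ℓ(v) = 0} β_v(x) v + (1 - t) · Σ_{ℓ(v) > 0} β_v(x) v`
stays in the carrier simplex, satisfies `ℓ(H_t x) = (1 - t) ℓ(x)` (so sublevel sets are
preserved and `H_1` lands in `Z`), `H_0 = id`, and fixes `Z` pointwise. The barycentric
coordinate `β_v` is realised globally as `plMap K 𝟙_{v}` (`baryCoord`), the simplexwise affine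
interpolation of the Kronecker vertex data, which makes `H` a single formula continuous on `|K|`.

Also: `ℓ ≥ 0` on `|K|` (`nonneg_of_mem_space`), the sublevel sets `{ℓ < ε}` are COFINAL among the
neighbourhoods of `Z` in `|K|` (`exists_sublevel_subset_of_isOpen`, compactness), so that `Z` has
arbitrarily small relatively open neighbourhoods in `|K|` of which it is a strong deformation retract
(`exists_isStrongDeformationRetractOf_nhds_zeroSet`).

Use (the named fact `Literature.AlgebraicGeometry.HodgeTheory.exists_homotopyEquiv_fiberToTube`,
reduction `exists_homotopyEquiv_fiberToTube_of_squeeze`): with a semialgebraic triangulation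
`Φ : |K| → T` of a compact neighbourhood `T` of a special fibre `X₀` compatible with `X₀` (made
full by one barycentric subdivision) and `ℓ = Σ_{v ∉ X₀} β_v`, this gives cofinal retracting
neighbourhoods of `X₀` (hypothesis (A')); with a triangulation of the FUNCTION `|u ∘ f|`
(`ℓ = |u ∘ f| ∘ Φ` simplexwise affine) it gives the deformation retraction of the tubes
`{|u ∘ f| < ε}` onto `X₀` outright. No named fact is introduced.

## References

* J. R. Munkres, *Elements of Algebraic Topology* (1984), §70, Lemma 70.1. [Munkres1984]
* C. P. Rourke, B. J. Sanderson, *Introduction to Piecewise-Linear Topology* (1972), 3.9–3.11.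
* L. van den Dries, *Tame Topology and O-minimal Structures* (1998), Ch. 8, (3.3)–(3.5). [Dries1998]
-/

noncomputable section

open Set Function
open scoped unitInterval Topology

namespace Literature.AlgebraicTopology.Homotopy

open Literature.Analysis.Convexity

namespace SimplicialRetract

variable {W : Type*} [NormedAddCommGroup W] [NormedSpace ℝ W] [FiniteDimensional ℝ W]

/-! ### Barycentric coordinates as simplexwise affine interpolations of Kronecker data -/

/-- The **barycentric coordinate** `β_v : W → ℝ` attached to a point `v` (a vertex of `K`): the
simplexwise affine interpolation on `K` of the Kronecker data `𝟙_{v}` — on each closed simplex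
`conv s` it is the `v`-th barycentric coordinate if `v ∈ s` and `0` otherwise
(`baryCoord_sum_smul`). [cite: Munkres1984, §1–§2] -/
def baryCoord (K : Geometry.SimplicialComplex ℝ W) (v : W) : W → ℝ :=
  plMap K (Set.indicator ({v} : Set W) (1 : W → ℝ))

variable {K : Geometry.SimplicialComplex ℝ W}

/-- **Barycentric coordinates of a convex combination**: for `s ∈ K` and convex weights `w` on `s`,
`β_v (Σ_{u ∈ s} w_u u) = w_v` if `v ∈ s` and `0` otherwise. [cite: Munkres1984, §1–§2] -/
theorem baryCoord_sum_smul [DecidableEq W] {s : Finset W} (hs : s ∈ K.faces) {w : W → ℝ}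
    (hw0 : ∀ u ∈ s, 0 ≤ w u) (hw1 : ∑ u ∈ s, w u = 1) (v : W) :
    baryCoord K v (∑ u ∈ s, w u • u) = if v ∈ s then w v else 0 := by
  unfold baryCoord
  rw [plMap_sum_smul hs hw0 hw1]
  have h : ∀ u ∈ s, w u • Set.indicator ({v} : Set W) (1 : W → ℝ) u = if u = v then w u else 0 := by
    intro u _
    by_cases huv : u = v
    · subst huv
      simp
    · simp [huv]
  rw [Finset.sum_congr rfl h]
  exact Finset.sum_ite_eq' s v w

/-- `β_v` is continuous on `|K|` for `K` finite. [folklore] -/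
theorem continuousOn_baryCoord (hfin : K.faces.Finite) (v : W) :
    ContinuousOn (baryCoord K v) K.space :=
  continuousOn_plMap hfin _

omit [FiniteDimensional ℝ W] in
/-- Every point of `|K|` is a convex combination of the vertices of a simplex of `K`. [folklore] -/
theorem exists_eq_sum_smul_of_mem_space {x : W} (hx : x ∈ K.space) :
    ∃ s ∈ K.faces, ∃ w : W → ℝ, (∀ u ∈ s, 0 ≤ w u) ∧ ∑ u ∈ s, w u = 1 ∧ ∑ u ∈ s, w u • u = x := by
  obtain ⟨s, hs, hxs⟩ := Geometry.SimplicialComplex.mem_space_iff.1 hx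
  obtain ⟨w, hw0, hw1, hwx⟩ := Finset.mem_convexHull'.1 hxs
  exact ⟨s, hs, w, hw0, hw1, hwx⟩

section Simplex

/-! In this section `x = Σ_{u ∈ s} w_u u` is a convex combination in the simplex `s ∈ K`
and `V ⊇ s` is a finite set of points (all the vertices of `K`, in the application). -/

variable [DecidableEq W] {s V : Finset W} {w : W → ℝ}

/-- Barycentric coordinates are non-negative. [folklore] -/
theorem baryCoord_nonneg (hs : s ∈ K.faces) (hw0 : ∀ u ∈ s, 0 ≤ w u) (hw1 : ∑ u ∈ s, w u = 1)
    (v : W) : 0 ≤ baryCoord K v (∑ u ∈ s, w u • u) := by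
  rw [baryCoord_sum_smul hs hw0 hw1]
  split_ifs with h
  · exact hw0 v h
  · exact le_rfl

/-- Barycentric coordinates of vertices outside the carrier simplex vanish. [folklore] -/
theorem baryCoord_of_not_mem (hs : s ∈ K.faces) (hw0 : ∀ u ∈ s, 0 ≤ w u) (hw1 : ∑ u ∈ s, w u = 1)
    {v : W} (hv : v ∉ s) : baryCoord K v (∑ u ∈ s, w u • u) = 0 := by
  rw [baryCoord_sum_smul hs hw0 hw1, if_neg hv]

/-- A sum over `V ⊇ s` weighted by barycentric coordinates is the corresponding sum over `s` with
the convex weights. [folklore] -/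
theorem sum_baryCoord_smul_fun (hs : s ∈ K.faces) (hw0 : ∀ u ∈ s, 0 ≤ w u)
    (hw1 : ∑ u ∈ s, w u = 1) (hsV : s ⊆ V) {M : Type*} [AddCommGroup M] [Module ℝ M] (φ : W → M) :
    ∑ v ∈ V, baryCoord K v (∑ u ∈ s, w u • u) • φ v = ∑ v ∈ s, w v • φ v := by
  rw [← Finset.sum_subset hsV (fun v _ hv => by
    rw [baryCoord_of_not_mem hs hw0 hw1 hv, zero_smul])]
  exact Finset.sum_congr rfl fun v hv => by rw [baryCoord_sum_smul hs hw0 hw1, if_pos hv]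

/-- Barycentric coordinates sum to `1` over any `V ⊇ s`. [folklore] -/
theorem sum_baryCoord (hs : s ∈ K.faces) (hw0 : ∀ u ∈ s, 0 ≤ w u) (hw1 : ∑ u ∈ s, w u = 1)
    (hsV : s ⊆ V) : ∑ v ∈ V, baryCoord K v (∑ u ∈ s, w u • u) = 1 := by
  have h := sum_baryCoord_smul_fun hs hw0 hw1 hsV (fun _ => (1 : ℝ))
  simp only [smul_eq_mul, mul_one] at h
  rw [h, hw1]

/-- **Reconstruction**: `Σ_{v ∈ V} β_v(x) v = x`. [cite: Munkres1984, §1–§2] -/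
theorem sum_baryCoord_smul (hs : s ∈ K.faces) (hw0 : ∀ u ∈ s, 0 ≤ w u) (hw1 : ∑ u ∈ s, w u = 1)
    (hsV : s ⊆ V) : ∑ v ∈ V, baryCoord K v (∑ u ∈ s, w u • u) • v = ∑ u ∈ s, w u • u :=
  sum_baryCoord_smul_fun hs hw0 hw1 hsV id

end Simplex

/-! ### Simplexwise affine non-negative functions -/

section Affine

variable {ℓ : W → ℝ}

omit [FiniteDimensional ℝ W] in
/-- A simplexwise affine function is, on a closed simplex, the convex combination of its vertex
values. [folklore] -/
theorem apply_sum_smul_eq {s : Finset W} (hℓ : ∃ A : W →ᵃ[ℝ] ℝ, EqOn ℓ A (convexHull ℝ (s : Set W)))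
    {c : W → ℝ} (hc0 : ∀ u ∈ s, 0 ≤ c u) (hc1 : ∑ u ∈ s, c u = 1) :
    ℓ (∑ u ∈ s, c u • u) = ∑ u ∈ s, c u * ℓ u := by
  obtain ⟨A, hA⟩ := hℓ
  have hx : ∑ u ∈ s, c u • u ∈ convexHull ℝ (s : Set W) :=
    (convex_convexHull ℝ _).sum_mem hc0 hc1 fun u hu => subset_convexHull ℝ _ hu
  rw [hA hx]
  have h := affineMap_apply_sum_smul (t := s) (g := ℓ) (A := A)
    (fun v hv => (hA (subset_convexHull ℝ _ hv)).symm) hc1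
  simpa only [smul_eq_mul] using h

omit [FiniteDimensional ℝ W] in
/-- Vertices of faces are vertices: `ℓ ≥ 0` there. [folklore] -/
theorem nonneg_of_mem_face (hℓ0 : ∀ v ∈ K.vertices, 0 ≤ ℓ v) {s : Finset W} (hs : s ∈ K.faces)
    {v : W} (hv : v ∈ s) : 0 ≤ ℓ v := by
  refine hℓ0 v ?_
  rw [Geometry.SimplicialComplex.vertices_eq]
  exact Set.mem_biUnion hs hv

omit [FiniteDimensional ℝ W] in
/-- A simplexwise affine function `≥ 0` at the vertices is `≥ 0` on `|K|`. [folklore] -/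
theorem nonneg_of_mem_space
    (hℓ : ∀ s ∈ K.faces, ∃ A : W →ᵃ[ℝ] ℝ, EqOn ℓ A (convexHull ℝ (s : Set W)))
    (hℓ0 : ∀ v ∈ K.vertices, 0 ≤ ℓ v) {x : W} (hx : x ∈ K.space) : 0 ≤ ℓ x := by
  obtain ⟨s, hs, w, hw0, hw1, rfl⟩ := exists_eq_sum_smul_of_mem_space hx
  rw [apply_sum_smul_eq (hℓ s hs) hw0 hw1]
  exact Finset.sum_nonneg fun u hu => mul_nonneg (hw0 u hu) (nonneg_of_mem_face hℓ0 hs hu)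

/-- A simplexwise affine function is continuous on `|K|` (`K` finite). [folklore] -/
theorem continuousOn_of_simplexwiseAffine (hfin : K.faces.Finite)
    (hℓ : ∀ s ∈ K.faces, ∃ A : W →ᵃ[ℝ] ℝ, EqOn ℓ A (convexHull ℝ (s : Set W))) :
    ContinuousOn ℓ K.space :=
  continuousOn_space_of_forall hfin fun s hs => by
    obtain ⟨A, hA⟩ := hℓ s hs
    exact (A.continuous_of_finiteDimensional.continuousOn).congr hA

end Affine

/-! ### The deformation -/

section Deformation

variable [DecidableEq W]

/-- `λ(x) = Σ_{v ∈ P} β_v(x)`: the total barycentric weight of `x` on the finite set `P` of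
vertices (those where `ℓ > 0`, in the application). [cite: Munkres1984, Lemma 70.1] -/
def weightOn (K : Geometry.SimplicialComplex ℝ W) (P : Finset W) (x : W) : ℝ :=
  ∑ v ∈ P, baryCoord K v x

/-- The part of `x` carried by the vertices in `P`: `Σ_{v ∈ P} β_v(x) v`. [folklore] -/
def partOn (K : Geometry.SimplicialComplex ℝ W) (P : Finset W) (x : W) : W :=
  ∑ v ∈ P, baryCoord K v x • v

/-- **The deformation** `H_t(x) = (1 - (1-t)λ(x))/(1 - λ(x)) · Σ_{v ∈ V ∖ P} β_v(x) v
+ (1 - t) · Σ_{v ∈ P} β_v(x) v` pushing `|K| ∩ {λ < 1}` away from the vertices in `P` onto the span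
of the remaining vertices (`V` = all vertices). [cite: Munkres1984, Lemma 70.1] -/
def deform (K : Geometry.SimplicialComplex ℝ W) (V P : Finset W) (t : ℝ) (x : W) : W :=
  ((1 - (1 - t) * weightOn K P x) / (1 - weightOn K P x)) • partOn K (V \ P) x +
    (1 - t) • partOn K P x

/-- The coefficients of `H_t(x)` as a combination of the vertices. [folklore] -/
def coeff (K : Geometry.SimplicialComplex ℝ W) (P : Finset W) (t : ℝ) (x : W) (v : W) : ℝ :=
  if v ∈ P then (1 - t) * baryCoord K v x
  else (1 - (1 - t) * weightOn K P x) / (1 - weightOn K P x) * baryCoord K v x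

variable {V P s : Finset W} {w : W → ℝ}

/-- `H_t(x) = Σ_{v ∈ V} c_v v` with the coefficients `coeff`. [folklore] -/
theorem deform_eq_sum_coeff (hPV : P ⊆ V) (t : ℝ) (x : W) :
    deform K V P t x = ∑ v ∈ V, coeff K P t x v • v := by
  rw [deform, partOn, partOn, ← Finset.sum_sdiff hPV, Finset.smul_sum, Finset.smul_sum]
  congr 1
  · refine Finset.sum_congr rfl fun v hv => ?_
    rw [coeff, if_neg (Finset.mem_sdiff.1 hv).2, smul_smul]
  · refine Finset.sum_congr rfl fun v hv => ?_
    rw [coeff, if_pos hv, smul_smul]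

/-- On the simplex `s`: `λ(x) + Σ_{v ∈ V ∖ P} β_v(x) = 1`. [folklore] -/
theorem weightOn_add_sum_sdiff (hPV : P ⊆ V) (hs : s ∈ K.faces) (hsV : s ⊆ V)
    (hw0 : ∀ u ∈ s, 0 ≤ w u) (hw1 : ∑ u ∈ s, w u = 1) :
    weightOn K P (∑ u ∈ s, w u • u) + ∑ v ∈ V \ P, baryCoord K v (∑ u ∈ s, w u • u) = 1 := by
  rw [weightOn, add_comm, Finset.sum_sdiff hPV]
  exact sum_baryCoord hs hw0 hw1 hsV

/-- `0 ≤ λ(x)`. [folklore] -/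
theorem weightOn_nonneg (hs : s ∈ K.faces) (hw0 : ∀ u ∈ s, 0 ≤ w u) (hw1 : ∑ u ∈ s, w u = 1) :
    0 ≤ weightOn K P (∑ u ∈ s, w u • u) :=
  Finset.sum_nonneg fun v _ => baryCoord_nonneg hs hw0 hw1 v

/-- The coefficients of `H_t(x)` vanish off the carrier simplex. [folklore] -/
theorem coeff_of_not_mem (hs : s ∈ K.faces) (hw0 : ∀ u ∈ s, 0 ≤ w u) (hw1 : ∑ u ∈ s, w u = 1)
    (t : ℝ) {v : W} (hv : v ∉ s) : coeff K P t (∑ u ∈ s, w u • u) v = 0 := by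
  unfold coeff
  rw [baryCoord_of_not_mem hs hw0 hw1 hv]
  split_ifs <;> simp

/-- The coefficients of `H_t(x)` are non-negative for `t ∈ [0, 1]` when `λ(x) < 1`. [folklore] -/
theorem coeff_nonneg (hs : s ∈ K.faces) (hw0 : ∀ u ∈ s, 0 ≤ w u) (hw1 : ∑ u ∈ s, w u = 1)
    {t : ℝ} (ht0 : 0 ≤ t) (ht1 : t ≤ 1) (hlt : weightOn K P (∑ u ∈ s, w u • u) < 1) (v : W) :
    0 ≤ coeff K P t (∑ u ∈ s, w u • u) v := by
  have hβ := baryCoord_nonneg (K := K) hs hw0 hw1 v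
  have hlam0 := weightOn_nonneg (K := K) (P := P) hs hw0 hw1
  unfold coeff
  split_ifs
  · exact mul_nonneg (by linarith) hβ
  · refine mul_nonneg (div_nonneg ?_ (by linarith)) hβ
    nlinarith

/-- The coefficients of `H_t(x)` sum to `1` over `V` when `λ(x) < 1`. [folklore] -/
theorem sum_coeff (hPV : P ⊆ V) (hs : s ∈ K.faces) (hsV : s ⊆ V) (hw0 : ∀ u ∈ s, 0 ≤ w u)
    (hw1 : ∑ u ∈ s, w u = 1) (t : ℝ) (hlt : weightOn K P (∑ u ∈ s, w u • u) < 1) :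
    ∑ v ∈ V, coeff K P t (∑ u ∈ s, w u • u) v = 1 := by
  set x := ∑ u ∈ s, w u • u with hx
  rw [← Finset.sum_sdiff hPV (f := fun v => coeff K P t x v)]
  have h1 : ∑ v ∈ V \ P, coeff K P t x v =
      (1 - (1 - t) * weightOn K P x) / (1 - weightOn K P x) * ∑ v ∈ V \ P, baryCoord K v x := by
    rw [Finset.mul_sum]
    refine Finset.sum_congr rfl fun v hv => ?_
    rw [coeff, if_neg (Finset.mem_sdiff.1 hv).2]
  have h2 : ∑ v ∈ P, coeff K P t x v = (1 - t) * weightOn K P x := by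
    rw [weightOn, Finset.mul_sum]
    refine Finset.sum_congr rfl fun v hv => ?_
    rw [coeff, if_pos hv]
  have h3 : ∑ v ∈ V \ P, baryCoord K v x = 1 - weightOn K P x := by
    have := weightOn_add_sum_sdiff (K := K) hPV hs hsV hw0 hw1
    rw [← hx] at this
    linarith
  rw [h1, h2, h3]
  have hne : 1 - weightOn K P x ≠ 0 := by linarith
  rw [div_mul_cancel₀ _ hne]
  ring

/-- The coefficients of `H_t(x)` sum to `1` over the carrier simplex. [folklore] -/
theorem sum_coeff_carrier (hPV : P ⊆ V) (hs : s ∈ K.faces) (hsV : s ⊆ V) (hw0 : ∀ u ∈ s, 0 ≤ w u)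
    (hw1 : ∑ u ∈ s, w u = 1) (t : ℝ) (hlt : weightOn K P (∑ u ∈ s, w u • u) < 1) :
    ∑ v ∈ s, coeff K P t (∑ u ∈ s, w u • u) v = 1 := by
  rw [← sum_coeff hPV hs hsV hw0 hw1 t hlt]
  exact Finset.sum_subset hsV fun v _ hv => coeff_of_not_mem hs hw0 hw1 t hv

/-- `H_t(x)` as a combination of the vertices of the carrier simplex. [folklore] -/
theorem deform_eq_sum_carrier (hPV : P ⊆ V) (hs : s ∈ K.faces) (hsV : s ⊆ V)
    (hw0 : ∀ u ∈ s, 0 ≤ w u) (hw1 : ∑ u ∈ s, w u = 1) (t : ℝ) :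
    deform K V P t (∑ u ∈ s, w u • u) = ∑ v ∈ s, coeff K P t (∑ u ∈ s, w u • u) v • v := by
  rw [deform_eq_sum_coeff hPV]
  symm
  exact Finset.sum_subset hsV fun v _ hv => by
    rw [coeff_of_not_mem hs hw0 hw1 t hv, zero_smul]

/-- **`H_t(x)` stays in the carrier simplex** (for `t ∈ [0, 1]` and `λ(x) < 1`).
[cite: Munkres1984, Lemma 70.1] -/
theorem deform_mem_convexHull (hPV : P ⊆ V) (hs : s ∈ K.faces) (hsV : s ⊆ V)
    (hw0 : ∀ u ∈ s, 0 ≤ w u) (hw1 : ∑ u ∈ s, w u = 1) {t : ℝ} (ht0 : 0 ≤ t) (ht1 : t ≤ 1)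
    (hlt : weightOn K P (∑ u ∈ s, w u • u) < 1) :
    deform K V P t (∑ u ∈ s, w u • u) ∈ convexHull ℝ (s : Set W) := by
  rw [deform_eq_sum_carrier hPV hs hsV hw0 hw1 t]
  exact (convex_convexHull ℝ _).sum_mem (fun v _ => coeff_nonneg hs hw0 hw1 ht0 ht1 hlt v)
    (sum_coeff_carrier hPV hs hsV hw0 hw1 t hlt) fun v hv => subset_convexHull ℝ _ hv

/-- **`H_0 = id`** (when `λ(x) < 1`). [cite: Munkres1984, Lemma 70.1] -/
theorem deform_zero (hPV : P ⊆ V) (hs : s ∈ K.faces) (hsV : s ⊆ V) (hw0 : ∀ u ∈ s, 0 ≤ w u)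
    (hw1 : ∑ u ∈ s, w u = 1) (hlt : weightOn K P (∑ u ∈ s, w u • u) < 1) :
    deform K V P 0 (∑ u ∈ s, w u • u) = ∑ u ∈ s, w u • u := by
  have hne : 1 - weightOn K P (∑ u ∈ s, w u • u) ≠ 0 := by linarith
  rw [deform, sub_zero, one_mul, div_self hne, one_smul, one_smul, partOn, partOn,
    Finset.sum_sdiff hPV]
  exact sum_baryCoord_smul hs hw0 hw1 hsV

end Deformation

/-! ### The value of `ℓ` along the deformation -/

section Value

variable [DecidableEq W]

/-- The set `P = {v ∈ V : ℓ v > 0}` of "positive" vertices. [folklore] -/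
def posVertices (ℓ : W → ℝ) (V : Finset W) : Finset W :=
  V.filter fun v => 0 < ℓ v

omit [NormedAddCommGroup W] [NormedSpace ℝ W] [FiniteDimensional ℝ W] [DecidableEq W] in
/-- `P ⊆ V`. [folklore] -/
theorem posVertices_subset (ℓ : W → ℝ) (V : Finset W) : posVertices ℓ V ⊆ V :=
  Finset.filter_subset _ _

omit [NormedAddCommGroup W] [NormedSpace ℝ W] [FiniteDimensional ℝ W] [DecidableEq W] in
/-- Membership in `P`. [folklore] -/
theorem mem_posVertices {ℓ : W → ℝ} {V : Finset W} {v : W} :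
    v ∈ posVertices ℓ V ↔ v ∈ V ∧ 0 < ℓ v :=
  Finset.mem_filter

variable {ℓ : W → ℝ} {V s : Finset W} {w : W → ℝ}

omit [FiniteDimensional ℝ W] [DecidableEq W] in
/-- A vertex of `s ⊆ V` outside `P` has `ℓ = 0`. [folklore] -/
theorem apply_eq_zero_of_not_mem_posVertices (hℓ0 : ∀ v ∈ K.vertices, 0 ≤ ℓ v) (hs : s ∈ K.faces)
    (hsV : s ⊆ V) {v : W} (hv : v ∈ s) (hvP : v ∉ posVertices ℓ V) : ℓ v = 0 := by
  have h1 : ¬ 0 < ℓ v := fun h => hvP (mem_posVertices.2 ⟨hsV hv, h⟩)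
  exact le_antisymm (not_lt.1 h1) (nonneg_of_mem_face hℓ0 hs hv)

/-- **`ℓ(x) ≥ ε λ(x)`** when `ε ≤ ℓ(v)` on the positive vertices. [cite: Munkres1984, Lemma 70.1] -/
theorem mul_weightOn_le_apply
    (hℓ : ∀ s ∈ K.faces, ∃ A : W →ᵃ[ℝ] ℝ, EqOn ℓ A (convexHull ℝ (s : Set W)))
    (hℓ0 : ∀ v ∈ K.vertices, 0 ≤ ℓ v) (hs : s ∈ K.faces) (hw0 : ∀ u ∈ s, 0 ≤ w u)
    (hw1 : ∑ u ∈ s, w u = 1) {ε : ℝ} (hεℓ : ∀ v ∈ K.vertices, 0 < ℓ v → ε ≤ ℓ v) :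
    ε * weightOn K (posVertices ℓ V) (∑ u ∈ s, w u • u) ≤ ℓ (∑ u ∈ s, w u • u) := by
  rw [apply_sum_smul_eq (hℓ s hs) hw0 hw1, weightOn, Finset.mul_sum]
  -- restrict the left sum to `s` (coordinates vanish off `s`) and compare termwise
  have hL : ∑ v ∈ posVertices ℓ V, ε * baryCoord K v (∑ u ∈ s, w u • u) =
      ∑ v ∈ s, if v ∈ posVertices ℓ V then ε * w v else 0 := by
    rw [← Finset.sum_filter]
    have hsub : s.filter (fun v => v ∈ posVertices ℓ V) ⊆ posVertices ℓ V :=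
      fun v hv => (Finset.mem_filter.1 hv).2
    rw [← Finset.sum_subset hsub (fun v hvP hv => by
      have hvs : v ∉ s := fun h => hv (Finset.mem_filter.2 ⟨h, hvP⟩)
      rw [baryCoord_of_not_mem hs hw0 hw1 hvs, mul_zero])]
    refine Finset.sum_congr rfl fun v hv => ?_
    rw [baryCoord_sum_smul hs hw0 hw1, if_pos (Finset.mem_filter.1 hv).1]
  rw [hL]
  refine Finset.sum_le_sum fun v hv => ?_
  split_ifs with hvP
  · have hv' : 0 < ℓ v := (mem_posVertices.1 hvP).2
    have hvK : v ∈ K.vertices := by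
      rw [Geometry.SimplicialComplex.vertices_eq]
      exact Set.mem_biUnion hs hv
    rw [mul_comm]
    exact mul_le_mul_of_nonneg_left (hεℓ v hvK hv') (hw0 v hv)
  · exact mul_nonneg (hw0 v hv) (nonneg_of_mem_face hℓ0 hs hv)

/-- On `{ℓ < ε}` one has `λ < 1`. [cite: Munkres1984, Lemma 70.1] -/
theorem weightOn_lt_one
    (hℓ : ∀ s ∈ K.faces, ∃ A : W →ᵃ[ℝ] ℝ, EqOn ℓ A (convexHull ℝ (s : Set W)))
    (hℓ0 : ∀ v ∈ K.vertices, 0 ≤ ℓ v) (hs : s ∈ K.faces) (hw0 : ∀ u ∈ s, 0 ≤ w u)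
    (hw1 : ∑ u ∈ s, w u = 1) {ε : ℝ} (hε : 0 < ε) (hεℓ : ∀ v ∈ K.vertices, 0 < ℓ v → ε ≤ ℓ v)
    (hx : ℓ (∑ u ∈ s, w u • u) < ε) :
    weightOn K (posVertices ℓ V) (∑ u ∈ s, w u • u) < 1 := by
  have h := mul_weightOn_le_apply (K := K) (V := V) hℓ hℓ0 hs hw0 hw1 hεℓ
  by_contra hge
  have hge' : 1 ≤ weightOn K (posVertices ℓ V) (∑ u ∈ s, w u • u) := not_lt.1 hge
  have : ε ≤ ε * weightOn K (posVertices ℓ V) (∑ u ∈ s, w u • u) := by nlinarith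
  linarith

/-- **`ℓ(H_t x) = (1 - t) ℓ(x)`** (for `t ∈ [0, 1]`, `λ(x) < 1`). [cite: Munkres1984, Lemma 70.1] -/
theorem apply_deform
    (hℓ : ∀ s ∈ K.faces, ∃ A : W →ᵃ[ℝ] ℝ, EqOn ℓ A (convexHull ℝ (s : Set W)))
    (hℓ0 : ∀ v ∈ K.vertices, 0 ≤ ℓ v) (hs : s ∈ K.faces) (hsV : s ⊆ V) (hw0 : ∀ u ∈ s, 0 ≤ w u)
    (hw1 : ∑ u ∈ s, w u = 1) {t : ℝ} (ht0 : 0 ≤ t) (ht1 : t ≤ 1)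
    (hlt : weightOn K (posVertices ℓ V) (∑ u ∈ s, w u • u) < 1) :
    ℓ (deform K V (posVertices ℓ V) t (∑ u ∈ s, w u • u)) = (1 - t) * ℓ (∑ u ∈ s, w u • u) := by
  have hPV : posVertices ℓ V ⊆ V := posVertices_subset ℓ V
  rw [deform_eq_sum_carrier hPV hs hsV hw0 hw1 t,
    apply_sum_smul_eq (hℓ s hs) (fun v _ => coeff_nonneg hs hw0 hw1 ht0 ht1 hlt v)
      (sum_coeff_carrier hPV hs hsV hw0 hw1 t hlt),
    apply_sum_smul_eq (hℓ s hs) hw0 hw1, Finset.mul_sum]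
  refine Finset.sum_congr rfl fun v hv => ?_
  by_cases hvP : v ∈ posVertices ℓ V
  · rw [coeff, if_pos hvP, baryCoord_sum_smul hs hw0 hw1, if_pos hv]
    ring
  · rw [apply_eq_zero_of_not_mem_posVertices hℓ0 hs hsV hv hvP]
    simp

/-- On the zero set the positive vertices carry no weight. [folklore] -/
theorem baryCoord_eq_zero_of_apply_eq_zero
    (hℓ : ∀ s ∈ K.faces, ∃ A : W →ᵃ[ℝ] ℝ, EqOn ℓ A (convexHull ℝ (s : Set W)))
    (hℓ0 : ∀ v ∈ K.vertices, 0 ≤ ℓ v) (hs : s ∈ K.faces) (hw0 : ∀ u ∈ s, 0 ≤ w u)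
    (hw1 : ∑ u ∈ s, w u = 1) (hx : ℓ (∑ u ∈ s, w u • u) = 0) {v : W}
    (hvP : v ∈ posVertices ℓ V) : baryCoord K v (∑ u ∈ s, w u • u) = 0 := by
  rw [baryCoord_sum_smul hs hw0 hw1]
  split_ifs with hv
  · rw [apply_sum_smul_eq (hℓ s hs) hw0 hw1] at hx
    have hterm := (Finset.sum_eq_zero_iff_of_nonneg fun u hu =>
      mul_nonneg (hw0 u hu) (nonneg_of_mem_face hℓ0 hs hu)).1 hx v hv
    rcases mul_eq_zero.1 hterm with h | h
    · exact h
    · exact absurd h (ne_of_gt (mem_posVertices.1 hvP).2)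
  · rfl

/-- **`H_t` fixes the zero set pointwise.** [cite: Munkres1984, Lemma 70.1] -/
theorem deform_of_apply_eq_zero
    (hℓ : ∀ s ∈ K.faces, ∃ A : W →ᵃ[ℝ] ℝ, EqOn ℓ A (convexHull ℝ (s : Set W)))
    (hℓ0 : ∀ v ∈ K.vertices, 0 ≤ ℓ v) (hs : s ∈ K.faces) (hsV : s ⊆ V) (hw0 : ∀ u ∈ s, 0 ≤ w u)
    (hw1 : ∑ u ∈ s, w u = 1) (t : ℝ) (hx : ℓ (∑ u ∈ s, w u • u) = 0) :
    deform K V (posVertices ℓ V) t (∑ u ∈ s, w u • u) = ∑ u ∈ s, w u • u := by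
  have hPV : posVertices ℓ V ⊆ V := posVertices_subset ℓ V
  have hlam : weightOn K (posVertices ℓ V) (∑ u ∈ s, w u • u) = 0 :=
    Finset.sum_eq_zero fun v hv => baryCoord_eq_zero_of_apply_eq_zero hℓ hℓ0 hs hw0 hw1 hx hv
  have hpart : partOn K (posVertices ℓ V) (∑ u ∈ s, w u • u) = 0 :=
    Finset.sum_eq_zero fun v hv => by
      rw [baryCoord_eq_zero_of_apply_eq_zero hℓ hℓ0 hs hw0 hw1 hx hv, zero_smul]
  have hrest : partOn K (V \ posVertices ℓ V) (∑ u ∈ s, w u • u) = ∑ u ∈ s, w u • u := by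
    have h := sum_baryCoord_smul (K := K) hs hw0 hw1 hsV
    rw [← Finset.sum_sdiff hPV] at h
    change partOn K (V \ posVertices ℓ V) _ + partOn K (posVertices ℓ V) _ = _ at h
    rwa [hpart, add_zero] at h
  rw [deform, hlam, hpart, hrest]
  simp

end Value

/-! ### The theorem -/

section Main

variable {ℓ : W → ℝ}

omit [FiniteDimensional ℝ W] in
/-- The vertex set of a finite complex is finite. [folklore] -/
theorem finite_vertices (hfin : K.faces.Finite) : K.vertices.Finite := by
  rw [Geometry.SimplicialComplex.vertices_eq]
  exact hfin.biUnion fun s _ => s.finite_toSet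

omit [FiniteDimensional ℝ W] in
/-- Faces lie in the vertex set. [folklore] -/
theorem subset_toFinset_vertices (hV : K.vertices.Finite) {s : Finset W} (hs : s ∈ K.faces) :
    s ⊆ hV.toFinset := fun v hv => by
  rw [Set.Finite.mem_toFinset, Geometry.SimplicialComplex.vertices_eq]
  exact Set.mem_biUnion hs hv

/-- `λ` is continuous on `|K|`. [folklore] -/
theorem continuousOn_weightOn [DecidableEq W] (hfin : K.faces.Finite) (P : Finset W) :
    ContinuousOn (weightOn K P) K.space := by
  unfold weightOn
  exact continuousOn_finsetSum P fun v _ => continuousOn_baryCoord hfin v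

/-- `partOn` is continuous on `|K|`. [folklore] -/
theorem continuousOn_partOn [DecidableEq W] (hfin : K.faces.Finite) (P : Finset W) :
    ContinuousOn (partOn K P) K.space := by
  unfold partOn
  exact continuousOn_finsetSum P fun v _ => (continuousOn_baryCoord hfin v).smul continuousOn_const

/-- **The zero set of a non-negative simplexwise affine function is a strong deformation retract of
its small sublevel sets.** Let `K` be a finite geometric simplicial complex, `ℓ : W → ℝ` affine on
each closed simplex of `K` and `≥ 0` at the vertices, `0 < ε`, and `ε ≤ ℓ(v)` for every vertex `v`
with `ℓ(v) > 0`. Then `{x ∈ |K| : ℓ x = 0}` is a strong deformation retract of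
`{x ∈ |K| : ℓ x < ε}`. (Munkres's Lemma 70.1 "`|L|` is a deformation retract of `N(L)` for a full
subcomplex `L`" is the case `ℓ = Σ_{v ∉ L} β_v`, `ε = 1`.) [cite: Munkres1984, Lemma 70.1]
[cite: Dries1998, Ch. 8 (3.3)] -/
theorem isStrongDeformationRetractOf_zeroSet_sublevel (hfin : K.faces.Finite)
    (hℓ : ∀ s ∈ K.faces, ∃ A : W →ᵃ[ℝ] ℝ, EqOn ℓ A (convexHull ℝ (s : Set W)))
    (hℓ0 : ∀ v ∈ K.vertices, 0 ≤ ℓ v) {ε : ℝ} (hε : 0 < ε)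
    (hεℓ : ∀ v ∈ K.vertices, 0 < ℓ v → ε ≤ ℓ v) :
    IsStrongDeformationRetractOf {x ∈ K.space | ℓ x = 0} {x ∈ K.space | ℓ x < ε} := by
  classical
  have hV : K.vertices.Finite := finite_vertices hfin
  set V : Finset W := hV.toFinset with hVdef
  have hsV : ∀ s ∈ K.faces, s ⊆ V := fun s hs => subset_toFinset_vertices hV hs
  set P : Finset W := posVertices ℓ V with hPdef
  have hPV : P ⊆ V := posVertices_subset ℓ V
  set S : Set W := {x ∈ K.space | ℓ x < ε} with hSdef
  have hSK : S ⊆ K.space := fun x hx => hx.1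
  -- on `S`, `λ < 1`
  have hlt : ∀ {s : Finset W} (hs : s ∈ K.faces) {w : W → ℝ} (hw0 : ∀ u ∈ s, 0 ≤ w u)
      (hw1 : ∑ u ∈ s, w u = 1), ℓ (∑ u ∈ s, w u • u) < ε →
      weightOn K P (∑ u ∈ s, w u • u) < 1 := fun hs _ hw0 hw1 hx =>
    weightOn_lt_one hℓ hℓ0 hs hw0 hw1 hε hεℓ hx
  refine IsStrongDeformationRetractOf.of_continuousOn (deform K V P) ?_ ?_ ?_ ?_ ?_
  · -- continuity on `[0, 1] × S`
    have hwt : ContinuousOn (fun p : ℝ × W => weightOn K P p.2) (Icc (0 : ℝ) 1 ×ˢ S) :=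
      ((continuousOn_weightOn hfin P).mono hSK).comp continuousOn_snd fun p hp => hp.2
    have hp1 : ContinuousOn (fun p : ℝ × W => partOn K (V \ P) p.2) (Icc (0 : ℝ) 1 ×ˢ S) :=
      ((continuousOn_partOn hfin (V \ P)).mono hSK).comp continuousOn_snd fun p hp => hp.2
    have hp2 : ContinuousOn (fun p : ℝ × W => partOn K P p.2) (Icc (0 : ℝ) 1 ×ˢ S) :=
      ((continuousOn_partOn hfin P).mono hSK).comp continuousOn_snd fun p hp => hp.2
    have ht : ContinuousOn (fun p : ℝ × W => p.1) (Icc (0 : ℝ) 1 ×ˢ S) := continuousOn_fst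
    have hden : ∀ p ∈ Icc (0 : ℝ) 1 ×ˢ S, 1 - weightOn K P p.2 ≠ 0 := by
      rintro ⟨t, x⟩ ⟨-, hx⟩
      obtain ⟨s, hs, w, hw0, hw1, rfl⟩ := exists_eq_sum_smul_of_mem_space hx.1
      have := hlt hs hw0 hw1 hx.2
      exact fun h => by simp only at h; linarith
    change ContinuousOn (fun p : ℝ × W => ((1 - (1 - p.1) * weightOn K P p.2) /
      (1 - weightOn K P p.2)) • partOn K (V \ P) p.2 + (1 - p.1) • partOn K P p.2) _
    exact ((((continuousOn_const.sub ((continuousOn_const.sub ht).mul hwt)).div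
      (continuousOn_const.sub hwt) hden).smul hp1).add ((continuousOn_const.sub ht).smul hp2))
  · -- `H_t` maps `S` into `S`
    rintro t ⟨ht0, ht1⟩ x ⟨hxK, hxε⟩
    obtain ⟨s, hs, w, hw0, hw1, rfl⟩ := exists_eq_sum_smul_of_mem_space hxK
    have h1 := hlt hs hw0 hw1 hxε
    refine ⟨K.convexHull_subset_space hs (deform_mem_convexHull hPV hs (hsV s hs) hw0 hw1 ht0 ht1 h1), ?_⟩
    show ℓ (deform K V P t (∑ u ∈ s, w u • u)) < ε
    rw [hPdef, apply_deform hℓ hℓ0 hs (hsV s hs) hw0 hw1 ht0 ht1 h1]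
    have h0 : 0 ≤ ℓ (∑ u ∈ s, w u • u) :=
      nonneg_of_mem_space hℓ hℓ0 (K.convexHull_subset_space hs
        ((convex_convexHull ℝ _).sum_mem hw0 hw1 fun u hu => subset_convexHull ℝ _ hu))
    nlinarith
  · -- `H_0 = id`
    rintro x ⟨hxK, hxε⟩
    obtain ⟨s, hs, w, hw0, hw1, rfl⟩ := exists_eq_sum_smul_of_mem_space hxK
    exact deform_zero hPV hs (hsV s hs) hw0 hw1 (hlt hs hw0 hw1 hxε)
  · -- `H_1` lands in the zero set
    rintro x ⟨hxK, hxε⟩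
    obtain ⟨s, hs, w, hw0, hw1, rfl⟩ := exists_eq_sum_smul_of_mem_space hxK
    have h1 := hlt hs hw0 hw1 hxε
    refine ⟨K.convexHull_subset_space hs
      (deform_mem_convexHull hPV hs (hsV s hs) hw0 hw1 zero_le_one le_rfl h1), ?_⟩
    show ℓ (deform K V P 1 (∑ u ∈ s, w u • u)) = 0
    rw [hPdef, apply_deform hℓ hℓ0 hs (hsV s hs) hw0 hw1 zero_le_one le_rfl h1]
    ring
  · -- `H_t` fixes the zero set
    rintro t - x ⟨hxK, -⟩ ⟨-, hx0⟩
    obtain ⟨s, hs, w, hw0, hw1, rfl⟩ := exists_eq_sum_smul_of_mem_space hxK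
    rw [hPdef]
    exact deform_of_apply_eq_zero hℓ hℓ0 hs (hsV s hs) hw0 hw1 t hx0

/-- **Sublevel sets are cofinal neighbourhoods of the zero set in `|K|`**: every open `O ⊇ Z`
contains `{x ∈ |K| : ℓ x < ε}` for some `ε > 0` (`|K| ∖ O` is compact and `ℓ > 0` on it).
[folklore] -/
theorem exists_sublevel_subset_of_isOpen (hfin : K.faces.Finite)
    (hℓ : ∀ s ∈ K.faces, ∃ A : W →ᵃ[ℝ] ℝ, EqOn ℓ A (convexHull ℝ (s : Set W)))
    (hℓ0 : ∀ v ∈ K.vertices, 0 ≤ ℓ v) {O : Set W} (hO : IsOpen O)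
    (hZO : {x ∈ K.space | ℓ x = 0} ⊆ O) :
    ∃ ε > 0, {x ∈ K.space | ℓ x < ε} ⊆ O := by
  have hC : IsCompact (K.space \ O) := (isCompact_space_of_finite hfin).diff hO
  by_cases hne : (K.space \ O).Nonempty
  · have hcont : ContinuousOn ℓ (K.space \ O) :=
      (continuousOn_of_simplexwiseAffine hfin hℓ).mono Set.sdiff_subset
    obtain ⟨x₀, hx₀, hmin⟩ := hC.exists_isMinOn hne hcont
    have hpos : 0 < ℓ x₀ := by
      rcases (nonneg_of_mem_space hℓ hℓ0 hx₀.1).lt_or_eq with h | h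
      · exact h
      · exact absurd (hZO ⟨hx₀.1, h.symm⟩) hx₀.2
    refine ⟨ℓ x₀, hpos, fun x hx => ?_⟩
    by_contra hxO
    have := hmin ⟨hx.1, hxO⟩
    exact absurd hx.2 (not_lt.2 this)
  · refine ⟨1, one_pos, fun x hx => ?_⟩
    by_contra hxO
    exact hne ⟨x, hx.1, hxO⟩

omit [FiniteDimensional ℝ W] in
/-- A positive lower bound for `ℓ` on the vertices where it is positive (finitely many).
[folklore] -/
theorem exists_pos_le_apply_vertices (hfin : K.faces.Finite) (ℓ : W → ℝ) :
    ∃ m > 0, ∀ v ∈ K.vertices, 0 < ℓ v → m ≤ ℓ v := by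
  have hVf : (K.vertices ∩ {v | 0 < ℓ v}).Finite := (finite_vertices hfin).inter_of_left _
  by_cases hne : (K.vertices ∩ {v | 0 < ℓ v}).Nonempty
  · obtain ⟨v₀, hv₀, hmin⟩ := Set.exists_min_image _ ℓ hVf hne
    exact ⟨ℓ v₀, hv₀.2, fun v hv hpos => hmin v ⟨hv, hpos⟩⟩
  · exact ⟨1, one_pos, fun v hv hpos => absurd ⟨v, hv, hpos⟩ hne⟩

/-- Sublevel sets are relatively open in `|K|`. [folklore] -/
theorem exists_isOpen_inter_eq_sublevel (hfin : K.faces.Finite)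
    (hℓ : ∀ s ∈ K.faces, ∃ A : W →ᵃ[ℝ] ℝ, EqOn ℓ A (convexHull ℝ (s : Set W))) (ε : ℝ) :
    ∃ O : Set W, IsOpen O ∧ K.space ∩ O = {x ∈ K.space | ℓ x < ε} := by
  obtain ⟨O, hO, hOeq⟩ := (continuousOn_iff'.1 (continuousOn_of_simplexwiseAffine hfin hℓ))
    (Iio ε) isOpen_Iio
  refine ⟨O, hO, ?_⟩
  rw [Set.inter_comm, ← hOeq]
  ext x
  simp only [mem_inter_iff, mem_preimage, mem_Iio, mem_setOf_eq]
  tauto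

/-- **The zero set has arbitrarily small sublevel neighbourhoods of which it is a strong
deformation retract**: for every open `O ⊇ Z = {x ∈ |K| : ℓ x = 0}` there is `ε > 0` with
`Z ⊆ {x ∈ |K| : ℓ x < ε} ⊆ O` and `Z` a strong deformation retract of `{x ∈ |K| : ℓ x < ε}`.
[cite: Munkres1984, Lemma 70.1] [cite: Dries1998, Ch. 8 (3.3)] -/
theorem exists_isStrongDeformationRetractOf_nhds_zeroSet (hfin : K.faces.Finite)
    (hℓ : ∀ s ∈ K.faces, ∃ A : W →ᵃ[ℝ] ℝ, EqOn ℓ A (convexHull ℝ (s : Set W)))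
    (hℓ0 : ∀ v ∈ K.vertices, 0 ≤ ℓ v) {O : Set W} (hO : IsOpen O)
    (hZO : {x ∈ K.space | ℓ x = 0} ⊆ O) :
    ∃ ε > 0, {x ∈ K.space | ℓ x < ε} ⊆ O ∧
      IsStrongDeformationRetractOf {x ∈ K.space | ℓ x = 0} {x ∈ K.space | ℓ x < ε} := by
  obtain ⟨ε₁, hε₁, hsub⟩ := exists_sublevel_subset_of_isOpen hfin hℓ hℓ0 hO hZO
  obtain ⟨m, hm, hmℓ⟩ := exists_pos_le_apply_vertices hfin ℓ
  refine ⟨min ε₁ m, lt_min hε₁ hm, fun x hx => hsub ⟨hx.1, lt_of_lt_of_le hx.2 (min_le_left _ _)⟩,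
    isStrongDeformationRetractOf_zeroSet_sublevel hfin hℓ hℓ0 (lt_min hε₁ hm)
      fun v hv hpos => (min_le_right _ _).trans (hmℓ v hv hpos)⟩

end Main

end SimplicialRetract

end Literature.AlgebraicTopology.Homotopy

end
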